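import Mathlib
import Mathlib.MeasureTheory.Function.LpSeminorm.Basic
import Mathlib.MeasureTheory.Function.LocallyIntegrable
import Literature.Analysis.FluidPDE.SelfSimilar
import Literature.Analysis.FluidPDE.MildSolution
import Literature.Analysis.FluidPDE.SuitableWeak
import Literature.Analysis.FluidPDE.AxisymmetricEuler
import Literature.Analysis.FluidPDE.NSWave0
import HarnessLib.Audit
import HarnessLib

/-!
# LiouvilleConjectureNS — CONJECTURE (obligation of NavierStokesRegularity/NavierStokesRegularity)

Unproven conjecture migrated by the gate from `Literature/Analysis/FluidPDE/SelfSimilarLiouville.lean` (`Literature.Analysis.FluidPDE.LiouvilleConjectureNS`): unproven conjectures are obligations of our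
theories, not literature facts (human ruling 2026-08-15). Provenance: KochNadirashviliSereginSverak2009. Routes use it as a crux item or via
`--conditional-bridge --conditional-on LiouvilleConjectureNS`; a proof goes in the sibling `Theorems/LiouvilleConjectureNSHolds.lean` as `theorem LiouvilleConjectureNS_holds : LiouvilleConjectureNS` so this file stays a conjecture LEAF that Literature/ may import.
-/

namespace Summit.NavierStokesRegularity.NavierStokesRegularity

open Literature Literature.Analysis Literature.Analysis.FluidPDE
open MeasureTheory Set Function Filter Topology TopologicalSpace
open scoped ContDiff NNReal ENNReal InnerProductSpace RealInnerProductSpace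
local notation "ℝ³" => EuclideanSpace ℝ (Fin 3)

/-- **ns.S22** (the Liouville conjecture (L) for Navier–Stokes; Seregin–Šverák, Comm. PDE 34
(2009), §1; Koch–Nadirashvili–Seregin–Šverák, Acta Math. 203 (2009), §1). Every bounded ancient
mild solution `u ∈ L^∞(ℝ³ × (−∞, 0))` (measurable slices, `AEStronglyMeasurable (u t)`, and
`Fluid.IsBoundedOn`) of the Navier–Stokes equations (`ν = 1`, `f = 0`) is constant: for every
`t < 0` there is `b ∈ ℝ³` with `u(t, ·) = b` a.e. ("constant" is rendered as *spatially constant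
on every slice*, since the duality-form mild class does not see a time-dependent constant `b(t)`,
and a.e. because it determines the slices only almost everywhere; KNSS 2009, §5, Thm 5.2 and the
module docstring). **Open**; it would exclude Type I blow-up. Stated as a `Prop` only. [cite: KochNadirashviliSereginSverak2009, §1] -/
@[conjecture] def LiouvilleConjectureNS : Prop :=
  ∀ u : ℝ → ℝ³ → ℝ³, FluidPDE.IsBoundedAncientMildSolution 1 u →
    (∀ t < 0, AEStronglyMeasurable (u t) volume) →
      ∀ t < 0, ∃ b : ℝ³, u t =ᵐ[volume] fun _ => b

end Summit.NavierStokesRegularity.NavierStokesRegularity
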